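import Literature.Analysis.FluidPDE.NSLerayHopf
import Literature.Analysis.FluidPDE.NSLerayHopfABCAssembly
import HarnessLib

/-!
# Barrier: non-uniqueness of Leray–Hopf solutions of the FORCED Navier–Stokes equations
(Albritton–Brué–Colombo 2022)

Barrier catalogue entry for `NavierStokesRegularity` (D-0021). **The catalogued barrier is the
named fact `ForcedLerayHopfNonuniquenessNarrow`** (first declaration below; structured barrier
docstring indexed by the gate): Albritton–Brué–Colombo's Thm. 1.2 with the force in the Bochner
class of Def. 1.1 (jointly measurable, `L¹(0,T; L²(ℝ³))`) and the printed extras (1.13) (both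
solutions in `L^∞_t L³_x`, Type-I bounded, classical for `t > 0`); it implies the Analysis-side
unit-viscosity fact `Literature.Analysis.FluidPDE.albritton_brue_colombo_unit`
(`NSLerayHopfABCScaling.lean`) and its every-viscosity form
(`ForcedLerayHopfNonuniquenessNarrow.forall_viscosity`), refutes the forced analogue of the
ns.S08 endpoint uniqueness clause (`ForcedLerayHopfNonuniquenessNarrow.not_forced_endpoint_uniqueness`),
and follows from Thm. 1.3-type profile data (`forcedLerayHopfNonuniquenessNarrow_of_similarityProfiles`).
History: the entry was first filed as `ForcedLerayHopfNonuniqueness`, *definitionally* the tree's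
ns.S20 `Literature.Analysis.FluidPDE.albritton_brue_colombo` (`NSLerayHopf.lean`); the refuter
barrier audit of 2026-08-16 NARROWED it (section "Audit"), and the verdict clean-up of
2026-08-16 DEPRECATED the original declaration as mis-stated (vacuous) in favour of
`ForcedLerayHopfNonuniquenessNarrow` (section "Verdict clean-up"); the deprecated declaration and
the three bookkeeping theorems that must name it are kept, statements byte-for-byte, in the
section "Deprecated" of the file.

## What is printed (D. Albritton, E. Brué, M. Colombo, Ann. of Math. 196 (2022) = arXiv:2112.03116)

* Def. 1.1: Leray–Hopf solution on `ℝ³ × (0,T)` with datum `u₀ ∈ L²` (divergence free) and force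
  `f ∈ L¹_t L²_x(ℝ³ × (0,T))`.
* Thm. 1.2 (Non-uniqueness): there exist `T > 0`, `f ∈ L¹_t L²_x(ℝ³ × (0,T))`, and two distinct
  suitable Leray–Hopf solutions `u`, `ū` on `ℝ³ × (0,T)` with body force `f` and initial
  condition `u₀ ≡ 0`. (Numbering as extracted from the arXiv source; the in-tree docstring calls
  it Thm. 1.1.)
* Thm. 1.3 (refined): a smooth compactly supported self-similar profile `Ū` with force profile
  `F̄` such that the linearised operator `L_ss` in similarity variables has an unstable
  eigenvalue; the second solution is `Ū`-self-similar plus the growing mode plus a perturbation.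
* §1 (comparison): the Jia–Šverák–Guillod programme for the unforced problem needs a spectral
  condition supported numerically; "the inclusion of a force gives us the freedom to search for a
  more explicit unstable profile".

## Audit (2026-08-16, refuter barrier audit, D-0021): outcome NARROWED

Three findings, with page-level evidence (PDF pages of the materialised sources).

1. **The aliased formal fact is vacuous (weaker than print).** `ForcedLerayHopfNonuniqueness` is
   definitionally ns.S20 `albritton_brue_colombo`, which quantifies the force only through the
   slice-wise class `MemLqLp 1 2 f (Ioo 0 T)` (no measurability of `t ↦ f t`); that rendering is
   PROVED in the tree from a degenerate non-measurable force
   (`Literature.Analysis.FluidPDE.ABCVacuity.rendering_is_vacuous`, `NSLerayHopfABCVacuity.lean`: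
   `u ≡ 0` and `v = tW` are two "Leray–Hopf solutions" because every Bochner pairing of the force
   is the junk value `0`). As a Lean proposition the catalogue fact is therefore true for the
   wrong reason and records nothing of the Albritton–Brué–Colombo mechanism; the faithful
   rendering of Def. 1.1's Bochner class carries the clause
   `AEStronglyMeasurable (Function.uncurry f) (volume.restrict (Ioo 0 T ×ˢ univ))` (tree:
   `Literature.Analysis.FluidPDE.albritton_brue_colombo_unit`, restated 2026-08-15, and
   `albritton_brue_colombo_unit_iff_forall_viscosity`). The narrowed fact
   `ForcedLerayHopfNonuniquenessNarrow` below carries it, implies the unit-viscosity fact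
   (`ForcedLerayHopfNonuniquenessNarrow.albritton_brue_colombo_unit`) and the old catalogue fact
   (`ForcedLerayHopfNonuniquenessNarrow.forcedLerayHopfNonuniqueness`), and is proved from
   Thm. 1.3-type profile data exactly like the unit-viscosity fact
   (`forcedLerayHopfNonuniquenessNarrow_of_similarityProfiles`, reusing
   `Literature.Analysis.FluidPDE.albritton_brue_colombo_unit_of_similarityProfiles`'s ingredients from
   `NSLerayHopfABCAssembly.lean`), so it adds no root debt beyond Thm. 1.3 (a)–(b) itself.
2. **The `blocks:` threshold of the original block is misplaced at the endpoint.** The printed pair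
   lies INSIDE the Escauriaza–Seregin–Šverák endpoint class: by (1.13), for every `p ∈ [2,∞]`,
   `‖ū(t)‖_{L^p} + ‖u(t)‖_{L^p} ≲ t^{(3/p−1)/2}`, i.e. both solutions are in `L^∞_t L^p_x` for
   every `p ∈ [2,3]` (`p = 3`: the ESS class) and obey the Type-I / Koch–Tataru-type bound
   `√t ‖u(t)‖_∞ ≲ 1` (`p = ∞`); they are smooth for `t > 0`, suitable with EQUALITY in the local
   energy inequality, and axisymmetric WITHOUT swirl [Albritton–Brué–Colombo 2022, p. 3 after
   Thm. 1.2; p. 5, Thm. 1.3 with (1.13)–(1.14) and the paragraph "Our solutions moreover do not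
   break the axisymmetric without swirl structure"]. Hence the FORCED analogue of the uniqueness
   clause of `Literature.Analysis.FluidPDE.ess_endpoint` (ns.S08: `u ∈ L^∞_t L³_x` Leray–Hopf ⟹
   unique among Leray–Hopf solutions with the same datum) is REFUTED for forces `f ∈ L¹_t L²_x`
   (formally: `ForcedLerayHopfNonuniquenessNarrow.not_forced_endpoint_uniqueness`), whereas the
   original block only claimed to block uniqueness "below the criticality" of ns.S07/ns.S08. What
   survives for the forced problem (`u₀ ∈ L²`, `f ∈ L²_t H⁻¹_x`, a class containing the ABC force):
   weak–strong uniqueness when one solution lies in `X_T^{(0)}` ⊇ `L^p_t L^q_x`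
   (`2/p + 3/q = 1`, `p < ∞`) ∪ `C([0,T]; L³)` [Lemarié-Rieusset 2016, Thm. 12.4 (p. 391) and
   Prop. 12.3 (p. 393), von Wahl]; and the endpoint `L^∞_t L³_x` itself PROVIDED the force is
   subcritical, `f ∈ L^∞_t L^p_x` for some `p ∈ (1,3)` [Lemarié-Rieusset 2016, Prop. 12.4 (b),
   p. 394, after Kozono–Sohr; the proof (p. 395) restarts from `u(T*) ∈ L³` with a LOCAL MILD
   `C_t L³` solution of the forced problem, which is exactly what the scale-invariant ABC force
   `f = t^{-3/2} F̄(x/√t)`, with `‖f(t)‖_{L^p} ≍ t^{(3/p−3)/2} → ∞` for every `p > 1` by (1.14),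
   does not admit at `T* = 0`]. The dividing line is therefore NOT "critical Lebesgue class of the
   solution" but "norm-continuity / smallness at `t = 0⁺` in a critical space, equivalently a
   force subcritical enough for a local critical-space mild solution" — the same line as in the
   sibling entry `CriticalDataSmoothNonuniqueness` (`L^∞_t` versus `C_t` of a critical norm).
3. **Scope updates (literature since 2022).** (a) Domains: the same non-uniqueness (still
   `u₀ ≡ 0`, `f ∈ L¹_t L²_x`, two suitable Leray–Hopf solutions) holds in every smooth bounded
   domain `Ω ⊂ ℝ³` with no-slip condition and on `𝕋³` [Albritton–Brué–Colombo 2023 (gluing),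
   Thm. 1.1, p. 3]; non-zero initial data are NOT printed there (the outer solution is `u ≡ 0`).
   (b) The evasion "`f = 0`" of the original block is now contested: Hou–Wang–Yang 2025
   (arXiv:2509.25116, Thm. 1, p. 3; computer-assisted, unrefereed as of 2026-08; in-tree
   claim-tagged predicate `HouWangYang2025.IsNonuniqueFamily`, no named fact) announce infinitely
   many suitable Leray–Hopf solutions of the UNFORCED system on `ℝ³ × [0,1]` from one compactly
   supported datum `u_in ∈ L^q` for all `q < 3` (so `u_in ∈ L²` but NOT `L³`: a scale-invariant
   singular core), in `L^s_t L^q_x` for all `3/q + 2/s > 1`. In both mechanisms the singularity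
   sits at the space–time origin at critical scaling — in the FORCE (ABC, `u₀ = 0`) or in the DATUM
   (Jia–Šverák / HWY, `f = 0`). (c) For Clay-type data (Schwartz `u₀`, `f ≡ 0` or Schwartz `f`)
   Leray–Hopf uniqueness is implied by global regularity (local smooth solution + weak–strong
   uniqueness) and Leray–Hopf NON-uniqueness would refute it; nothing printed bears on this case.

What the barrier blocks, sharply: every uniqueness principle for Leray–Hopf solutions of the
forced system whose hypotheses are met by {`ℝ³` (or `𝕋³`, bounded `Ω`), `u₀ = 0`, a force
`f = t^{-3/2}F̄(x/√t)` with `F̄ ∈ C_c^∞` — hence `f ∈ L^a_t L^b_x` for every `2/a + 3/b > 3`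
(e.g. `L¹_t L²_x`, `L^q_{t,x}` for `q < 5/3`; also `L²_t H⁻¹_x`) and for no `2/a + 3/b < 3`,
smooth off `(0,0)` —, solutions suitable,
smooth for `t > 0`, axisymmetric without swirl, in `L^∞_t L^p_x` for all `p ∈ [2,3]`, with
`sup_t √t‖u(t)‖_∞ < ∞`}. It does NOT block: uniqueness using a Prodi–Serrin class with `p < ∞`,
`C([0,T];L³)`, Kato-small classes, the endpoint class with a subcritical force
(`f ∈ L^∞_t L^p_x`, `1 < p < 3`, or any class in which the forced problem has local `C_t L³` mild
solutions), two space dimensions (Leray–Hopf solutions are unique there), or hyperdissipation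
`(-Δ)^γ`, `γ ≥ 5/4`.

## Verdict clean-up (2026-08-16): `ForcedLerayHopfNonuniqueness` deprecated as mis-stated

The tenured prove-seat of the original catalogue fact returned the verdict *misstated*, re-verified
here against the materialised source (arXiv:2112.03116, p. 3: Def. 1.1 takes
`f ∈ L¹_t L²_x(ℝ³ × (0,T))`, a Bochner space on the slab; Thm. 1.2 asks the equations in the sense
of distributions on `ℝ³ × (0,T)`) and the tree (`MemLqLp`, `IsWeakNSSolutionOn`, `IsLerayHopfOn`,
`ABCVacuity.rendering_is_vacuous`): `ForcedLerayHopfNonuniqueness` is definitionally ns.S20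
`albritton_brue_colombo`, which sees its force only through the slice-wise `MemLqLp 1 2 f (Ioo 0 T)`
(no measurability of `t ↦ f t`) and through Bochner time integrals that vanish on non-measurable
integrands, so it is VACUOUSLY TRUE in the tree (`ABCVacuity.rendering_is_vacuous` proves its body
verbatim) and can never be discharged as a formalisation of the printed theorem (details in the
docstring of the deprecated declaration). Treatment (restate; human ruling 2026-08-15): the
corrected statement is NOT meaning-preserving for the declaration's users — the sibling
`ForcedLerayHopfNonuniquenessProofs.lean` derives `ForcedLerayHopfNonuniqueness` from the
measurability-free single-viscosity rendering (`ForcedLerayHopfNonuniqueness.of_viscosity`), which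
does not give the corrected statement — so the correction lives under the NEW name
`ForcedLerayHopfNonuniquenessNarrow` (vendored by the audit: the measurability clause of Def. 1.1
plus the printed extras; minimal faithful Analysis-side forms `albritton_brue_colombo_unit`,
`albritton_brue_colombo_unit_iff_forall_viscosity`), now the FIRST declaration of the file and its
only catalogued barrier (the structured block was removed from the deprecated declaration, so the
gate's barrier index lists one entry for this result, not two; the token `leray-hopf-class` of the
old block was added to the narrowed block's `technique_class` so that no matching route escapes),
while the old declaration is `@[deprecated ForcedLerayHopfNonuniquenessNarrow]`, statement
byte-for-byte, and the three bookkeeping theorems that must name it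
(`forcedLerayHopfNonuniqueness_iff`, `ForcedLerayHopfNonuniqueness.at_viscosity_one`,
`ForcedLerayHopfNonuniquenessNarrow.forcedLerayHopfNonuniqueness`) are deprecated alongside (no
`linter.deprecated` override is needed: Lean does not report deprecated names inside deprecated
declarations). Routes and idea cards address the barrier as
`Literature.Barriers.NavierStokesRegularity.ForcedLerayHopfNonuniquenessNarrow`.

## References

* D. Albritton, E. Brué, M. Colombo, Ann. of Math. 196 (2022), 415–455. [`AlbrittonBrueColombo2022AnnMath`]
* D. Albritton, E. Brué, M. Colombo, *Gluing non-unique Navier–Stokes solutions*, Ann. PDE 9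
  (2023) = arXiv:2209.03530, Thm. 1.1. [`AlbrittonBrueColombo2023Gluing`]
* T. Y. Hou, Y. Wang, C. Yang, arXiv:2509.25116 (2025), Thm. 1. [`HouWangYang2025`]
* P. G. Lemarié-Rieusset, *The Navier–Stokes Problem in the 21st Century*, CRC 2016, Thm. 12.4,
  Prop. 12.3, Prop. 12.4 (pp. 391–395). [`LemarieRieusset2016`]
* H. Jia, V. Šverák, J. Funct. Anal. 268 (2015). [`JiaSverak2015`]
* T. Buckmaster, V. Vicol, Ann. of Math. 189 (2019). [`BuckmasterVicol2019AnnMath`]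
-/

noncomputable section

open MeasureTheory Set

namespace Literature.Barriers.NavierStokesRegularity

/-- **Barrier (Albritton–Brué–Colombo 2022): Leray–Hopf solutions of the forced Navier–Stokes
equations are not unique — NARROWED to the printed content (audit 2026-08-16); the catalogue
entry of this file since the verdict clean-up of 2026-08-16, superseding the deprecated
`ForcedLerayHopfNonuniqueness`.** At unit viscosity (as printed): there are `T > 0`, a body force `f` on
`(0,T) × ℝ³` which is JOINTLY (a.e.-strongly) MEASURABLE and lies in `L¹(0,T; L²(ℝ³))` — together
the Bochner class `f ∈ L¹_t L²_x(ℝ³ × (0,T))` of Def. 1.1 —, and two Leray–Hopf weak solutions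
`u`, `v` (accepted strict sense `IsLerayHopfOn T 1 f 0 ·`) from the ZERO datum which
(i) both lie in the Escauriaza–Seregin–Šverák endpoint class `L^∞(0,T; L³(ℝ³))`
((1.13) with `p = 3`, `k = 0`: the `L³` norm is scale invariant), (ii) both obey the Type-I bound
`√t ‖u(t,x)‖ ≤ M` ((1.13) with `p = ∞`, `k = 0`), (iii) are both classical (smooth velocity and
pressure, pointwise equations) on the open strip `(0,T) × ℝ³` ("smooth for positive times"),
and (iv) differ on a set of positive measure at some `t ∈ (0,T)`. Printed moreover, not recorded:
both are suitable with equality in the local energy inequality, axisymmetric without swirl, and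
`‖∇^k u(t)‖_{L^p} ≲ t^{(3/p−1−k)/2}` for all `p ∈ [2,∞]`, `k ≥ 0`; the force is the self-similar
`t^{-3/2}F̄(x/√t)`, `F̄ ∈ C_c^∞`. This statement implies the faithful unit-viscosity fact
`Literature.Analysis.FluidPDE.albritton_brue_colombo_unit`, its every-viscosity form
(`ForcedLerayHopfNonuniquenessNarrow.forall_viscosity`) and (forgetting measurability) the
deprecated every-viscosity rendering `ForcedLerayHopfNonuniqueness` = ns.S20
`albritton_brue_colombo`; it follows from Thm. 1.3-type
profile data (`forcedLerayHopfNonuniquenessNarrow_of_similarityProfiles`), so its only debt is the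
analytic core of the paper (Thm. 1.3 (a)–(b)), shared with `albritton_brue_colombo_unit`.
[cite: AlbrittonBrueColombo2022AnnMath, Thm. 1.2 with Def. 1.1; Thm. 1.3 with (1.13)–(1.14); p. 3 "smooth for positive times"]

BARRIER (structured block, D-0021):
technique_class: leray-hopf-class leray-hopf-uniqueness energy-inequality suitable-weak-solutions uniqueness-in-energy-class weak-solution-uniqueness endpoint-critical-class-uniqueness type-I-bound-uniqueness axisymmetric-no-swirl-reduction
blocks: every uniqueness principle for Leray–Hopf solutions of the FORCED Navier–Stokes system on `ℝ³` whose hypotheses are met by: zero datum; a jointly measurable force in `L¹_t L²_x` (indeed in `L^a_t L^b_x` for all `2/a + 3/b > 3` and in `L²_t H⁻¹_x`, smooth off the space–time origin, self-similar); solutions that are suitable, classical for `t > 0`, axisymmetric without swirl, in `L^∞_t L^p_x` for every `p ∈ [2,3]` and Type-I bounded (`sup_t √t‖u(t)‖_∞ < ∞`) — in particular the forced analogue of the uniqueness clause of ns.S08 `Literature.Analysis.FluidPDE.ess_endpoint` (`L^∞_t L³_x`), proved false here as `ForcedLerayHopfNonuniquenessNarrow.not_forced_endpoint_uniqueness`,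 and any "energy-class well-posedness" strengthening of the forced Clay problems (C)/(D) that tolerates `L¹_t L²_x` forces [cite: AlbrittonBrueColombo2022AnnMath, Thm. 1.2, Thm. 1.3, (1.13)–(1.14)]; by gluing, the same on `𝕋³` and on smooth bounded domains with no-slip condition [cite: AlbrittonBrueColombo2023Gluing, Thm. 1.1].
because: `Ū ∈ C_c^∞` (a long axisymmetric-no-swirl vortex ring with Vishik-unstable cross-section) is a steady state of the similarity-variable equations with the smooth compactly supported force profile `F̄ = −½(1+ξ·∇)Ū − ΔŪ + Ū·∇Ū`; `L_ss` has an unstable eigenvalue `λ`, `a = Re λ > 0`, with eigenfunction `η ∈ ∩_k H^k`; `ū = t^{-1/2}Ū(x/√t)` and `u = ū + u^{lin} + u^{per}` (`U^{lin} = Re(e^{λτ}η)`, `‖U^{per}(τ)‖_{H^k} ≲ e^{2aτ}`) are two suitable Leray–Hopf solutions from `u₀ ≡ 0` with force `f̄ = t^{-3/2}F̄(x/√t)`; all `L^p` bounds (1.13) follow from the similarity ansatz, and non-uniqueness "emerges" from the space–time origin, where the force is scale-critically singular, so that no local mild solution continuous into `L³` exists from `t = 0` [cite: AlbrittonBrueColombo2022AnnMath,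 Thm. 1.3 and §1.1].
evasions_known: (1) one solution in a Prodi–Serrin class `L^p_t L^q_x`, `2/p + 3/q = 1`, `p < ∞`, or in `C([0,T]; L³)`, or Kato-small near `t = 0`: weak–strong uniqueness holds for the forced problem with `u₀ ∈ L²`, `f ∈ L²_t H⁻¹_x` [cite: LemarieRieusset2016, Thm. 12.4 (p. 391) and Prop. 12.3 (p. 393)] (the unforced in-tree statements are ns.S07 `Literature.Analysis.FluidPDE.weak_strong_uniqueness` and ns.S08 `Literature.Analysis.FluidPDE.ess_endpoint`); (2) the endpoint `L^∞_t L³_x` WITH a subcritical force `f ∈ L^∞_t L^p_x`, `1 < p < 3` (Kozono–Sohr): uniqueness holds, the proof restarting from `u(T*) ∈ L³` with a local mild `C_t L³` solution of the forced problem [cite: LemarieRieusset2016, Prop. 12.4 (b) and its proof (pp. 394–395)] — the ABC force, `‖f(t)‖_{L^p} ≍ t^{(3/p−3)/2}`, is in no such class [cite: AlbrittonBrueColombo2022AnnMath, (1.14)]; (3) Clay-type data with `f ≡ 0` or Schwartz `f` (Clay (C), (D) require `f` smooth with space–time decay [cite: Fefferman2000, statements (C) (D) and (5) (9)]): Leray–Hopf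 uniqueness is then implied by global regularity (and its failure would disprove regularity) — nothing printed bears on it; unforced Leray–Hopf non-uniqueness itself is open (in-tree `Literature.Analysis.FluidPDE.LerayHopfNonUniqueness`; the Jia–Šverák programme reduces it to a spectral condition supported only numerically [cite: JiaSverak2015, Thm. 3 and §1] [cite: AlbrittonBrueColombo2022AnnMath, §1]), finite-energy weak solutions WITHOUT the energy inequality being already non-unique for `f = 0` on `𝕋³` [cite: BuckmasterVicol2019AnnMath, Thm. 1.2]; for ROUGH data the unforced evasion is contested by the computer-assisted, unrefereed claim of [cite: HouWangYang2025, Thm. 1] (datum in `L² ∩ L^{3−} ∖ L³`); (4) two space dimensions, or hyperdissipation `(-Δ)^γ` with `γ ≥ 5/4` (energy class subcritical): Leray–Hopf solutions are unique (folklore; Lions).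
scope_caveats: (a) unit viscosity, as printed; every `ν > 0` for the Leray–Hopf clauses by the proved scaling (`ForcedLerayHopfNonuniquenessNarrow.forall_viscosity`), the extra clauses (i)–(iii) rescale likewise but are not threaded here [cite: AlbrittonBrueColombo2022AnnMath, §1.1 (1.5)–(1.6)]; (b) `ℝ³` and `u₀ = 0` only: bounded domains / `𝕋³` are printed elsewhere [cite: AlbrittonBrueColombo2023Gluing, Thm. 1.1], NON-ZERO (e.g. generic smooth) data with the singular force are not printed anywhere, so a uniqueness theorem restricted to a class of non-zero data is formally untouched (the gluing heuristics suggest it fails as well); (c) suitability, the axisymmetric-no-swirl structure, the higher `(1.13)` bounds and the self-similar form of `f` are printed but not recorded in the formal statement [cite: AlbrittonBrueColombo2022AnnMath, Thm. 1.3 and §1.1]; (d) a statement about UNIQUENESS of weak solutions with a scale-critically singular force — it says nothing about regularity or blow-up from smooth data and smooth/zero force (Clay (A)–(D)), for which Leray–Hopf uniqueness on `[0,T*)` is a theorem (local smooth solution + weak–strong uniqueness).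
status: established -/
def ForcedLerayHopfNonuniquenessNarrow : Prop :=
  ∃ T : ℝ, 0 < T ∧ ∃ f : ℝ → EuclideanSpace ℝ (Fin 3) → EuclideanSpace ℝ (Fin 3),
    AEStronglyMeasurable (Function.uncurry f) (volume.restrict (Ioo 0 T ×ˢ univ)) ∧
    Literature.Analysis.FluidPDE.MemLqLp 1 2 f (Ioo 0 T) ∧
    ∃ u v : ℝ → EuclideanSpace ℝ (Fin 3) → EuclideanSpace ℝ (Fin 3),
      Literature.Analysis.FluidPDE.IsLerayHopfOn T 1 f 0 u ∧
      Literature.Analysis.FluidPDE.IsLerayHopfOn T 1 f 0 v ∧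
      Literature.Analysis.FluidPDE.MemLqLp ⊤ 3 u (Ioo 0 T) ∧
      Literature.Analysis.FluidPDE.MemLqLp ⊤ 3 v (Ioo 0 T) ∧
      (∃ M : ℝ, ∀ t ∈ Ioo 0 T, ∀ x, Real.sqrt t * ‖u t x‖ ≤ M ∧ Real.sqrt t * ‖v t x‖ ≤ M) ∧
      (∃ p q : ℝ → EuclideanSpace ℝ (Fin 3) → ℝ,
        Literature.Analysis.FluidPDE.IsClassicalNSSolutionOn (Ioo 0 T) 1 f u p ∧
        Literature.Analysis.FluidPDE.IsClassicalNSSolutionOn (Ioo 0 T) 1 f v q) ∧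
      ∃ t ∈ Ioo 0 T, ¬ (u t =ᵐ[volume] v t)

/-- **The narrowed fact implies the faithful unit-viscosity theorem** `albritton_brue_colombo_unit`
(`NSLerayHopfABCScaling.lean`): forget the clauses (i)–(iii). [cite: AlbrittonBrueColombo2022AnnMath, Thm. 1.2 with Def. 1.1] -/
theorem ForcedLerayHopfNonuniquenessNarrow.albritton_brue_colombo_unit
    (h : ForcedLerayHopfNonuniquenessNarrow) :
    Literature.Analysis.FluidPDE.albritton_brue_colombo_unit := by
  obtain ⟨T, hT, f, hfm, hf, u, v, hu, hv, -, -, -, -, ht⟩ := h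
  exact ⟨T, hT, f, hfm, hf, u, v, hu, hv, ht⟩

/-- **Every viscosity** (the Leray–Hopf clauses): from the narrowed fact, for every `ν > 0` there
are `T > 0`, a jointly measurable force in `L¹(0,T;L²)` and two Leray–Hopf solutions with
viscosity `ν` from `u₀ = 0` distinct at a time in `(0,T)` — the faithful every-viscosity form of
ns.S20 (`albritton_brue_colombo_unit_iff_forall_viscosity`, rescaling `u ↦ ν u(ν ·, ·)`,
`f ↦ ν² f(ν ·, ·)` on `(0, T/ν)`). [cite: AlbrittonBrueColombo2022AnnMath, §1.1 (1.5)–(1.6)] -/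
theorem ForcedLerayHopfNonuniquenessNarrow.forall_viscosity
    (h : ForcedLerayHopfNonuniquenessNarrow) :
    ∀ ν : ℝ, 0 < ν →
      ∃ T : ℝ, 0 < T ∧ ∃ f : ℝ → EuclideanSpace ℝ (Fin 3) → EuclideanSpace ℝ (Fin 3),
        AEStronglyMeasurable (Function.uncurry f) (volume.restrict (Ioo 0 T ×ˢ univ)) ∧
        Literature.Analysis.FluidPDE.MemLqLp 1 2 f (Ioo 0 T) ∧
        ∃ u v : ℝ → EuclideanSpace ℝ (Fin 3) → EuclideanSpace ℝ (Fin 3),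
          Literature.Analysis.FluidPDE.IsLerayHopfOn T ν f 0 u ∧
          Literature.Analysis.FluidPDE.IsLerayHopfOn T ν f 0 v ∧
            ∃ t ∈ Ioo 0 T, ¬ (u t =ᵐ[volume] v t) :=
  Literature.Analysis.FluidPDE.albritton_brue_colombo_unit_iff_forall_viscosity.1
    h.albritton_brue_colombo_unit

/-- **The exact endpoint uniqueness principle refuted by the narrowed barrier** (audit finding
(2)): it is FALSE that a Leray–Hopf solution `u` of the forced system at unit viscosity from the
zero datum, with a jointly measurable force `f ∈ L¹(0,T;L²)`, lying in the endpoint class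
`L^∞(0,T; L³(ℝ³))` of ns.S08 `Literature.Analysis.FluidPDE.ess_endpoint` — even Type-I bounded
(`√t‖u(t,x)‖ ≤ M`) and classical on `(0,T) × ℝ³` — is unique among Leray–Hopf solutions with the
same force and datum (slices compared on `(0,T]`, the shape of the uniqueness clause of
`ess_endpoint`). By contrast, for an UNFORCED solution this is the Escauriaza–Seregin–Šverák /
Kozono–Sohr theorem, and for a forced one it holds as soon as `f ∈ L^∞_t L^p_x` for some
`p ∈ (1,3)` (Lemarié-Rieusset 2016, Prop. 12.4 (b)): the barrier pins the failure on the
scale-critical singularity of the force at `t = 0`.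
[cite: AlbrittonBrueColombo2022AnnMath, Thm. 1.3 with (1.13)] [cite: LemarieRieusset2016, Prop. 12.4 (b), p. 394] -/
theorem ForcedLerayHopfNonuniquenessNarrow.not_forced_endpoint_uniqueness
    (h : ForcedLerayHopfNonuniquenessNarrow) :
    ¬ ∀ (T : ℝ) (f u v : ℝ → EuclideanSpace ℝ (Fin 3) → EuclideanSpace ℝ (Fin 3)), 0 < T →
        AEStronglyMeasurable (Function.uncurry f) (volume.restrict (Ioo 0 T ×ˢ univ)) →
        Literature.Analysis.FluidPDE.MemLqLp 1 2 f (Ioo 0 T) →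
        Literature.Analysis.FluidPDE.IsLerayHopfOn T 1 f 0 u →
        Literature.Analysis.FluidPDE.MemLqLp ⊤ 3 u (Ioo 0 T) →
        (∃ M : ℝ, ∀ t ∈ Ioo 0 T, ∀ x, Real.sqrt t * ‖u t x‖ ≤ M) →
        (∃ p : ℝ → EuclideanSpace ℝ (Fin 3) → ℝ,
          Literature.Analysis.FluidPDE.IsClassicalNSSolutionOn (Ioo 0 T) 1 f u p) →
        Literature.Analysis.FluidPDE.IsLerayHopfOn T 1 f 0 v →
        ∀ t ∈ Ioc 0 T, v t =ᵐ[volume] u t := by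
  intro hall
  obtain ⟨T, hT, f, hfm, hf, u, v, hu, hv, hu3, -, ⟨M, hM⟩, ⟨p, q, hup, -⟩, t, ht, hne⟩ := h
  exact hne ((hall T f u v hT hfm hf hu hu3 ⟨M, fun s hs x => (hM s hs x).1⟩ ⟨p, hup⟩ hv t
    ⟨ht.1, ht.2.le⟩).symm)

/-! ### Deprecated (verdict clean-up 2026-08-16): the vacuous every-viscosity rendering

`ForcedLerayHopfNonuniqueness` — the catalogue entry as first filed, definitionally ns.S20
`Literature.Analysis.FluidPDE.albritton_brue_colombo` — is mis-stated (no measurability of the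
force in time; vacuously provable, `ABCVacuity.rendering_is_vacuous`) and deprecated in favour of
`ForcedLerayHopfNonuniquenessNarrow` (module docstring, "Verdict clean-up"). It is kept, statement
byte-for-byte, together with the three bookkeeping theorems that must name it (each deprecated
with it, which is also what keeps `linter.deprecated` quiet inside them): its definitional
unfolding, its `ν = 1` instance, and the implication from the narrowed fact. Nothing in this section is a catalogued barrier (no
structured block). -/

/-- **Deprecated** (verdict clean-up 2026-08-16) — **mis-stated (vacuous as a Lean proposition)**;
superseded by `ForcedLerayHopfNonuniquenessNarrow` (above, the catalogued barrier), which adds the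
missing hypothesis — joint (a.e.-strong) measurability of the force on `(0,T) × ℝ³`,
`AEStronglyMeasurable (Function.uncurry f) (volume.restrict (Ioo 0 T ×ˢ univ))`, i.e. the
Bochner class `f ∈ L¹_t L²_x(ℝ³ × (0,T))` of Def. 1.1 instead of the slice-wise
`MemLqLp 1 2 f (Ioo 0 T)` alone — and records the printed extras (1.13); the minimal faithful
forms on the Analysis side are `Literature.Analysis.FluidPDE.albritton_brue_colombo_unit` (`ν = 1`)
and the right-hand side of `Literature.Analysis.FluidPDE.albritton_brue_colombo_unit_iff_forall_viscosity`
(every `ν > 0`, reached from the narrowed fact by `ForcedLerayHopfNonuniquenessNarrow.forall_viscosity`).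
*What is wrong:* this declaration is definitionally ns.S20 `albritton_brue_colombo`
(`NSLerayHopf.lean`), whose force is quantified only through `MemLqLp 1 2 f (Ioo 0 T)` — slices
`f t ∈ L²` for a.e. `t` and `∫⁻ ‖f t‖₂ dt < ∞`, NO measurability of `t ↦ f t` (`LerayHopf.lean`,
"v0 simplification") — while the force enters `IsWeakNSSolutionOn` / `IsLerayHopfOn` only through
the Bochner time integrals `∫ t in Ioo 0 T, ∫ x, (… + ⟪f t x, ψ t x⟫)` and
`∫ τ in s..t, ∫ x, ⟪f τ x, u τ x⟫`, which are the junk value `0` on integrands that are not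
a.e.-strongly measurable (`MeasureTheory.integral_non_aestronglyMeasurable`). Consequently the
statement is PROVED in the tree for the wrong reason — `Literature.Analysis.FluidPDE.ABCVacuity.rendering_is_vacuous`
(`NSLerayHopfABCVacuity.lean`) derives its body verbatim from `u ≡ 0`, `v t = t W` and a force
`f t = p(t) W + E (k t)` built on a partition of `(0,1)` into classes of full outer measure — and
records nothing of Albritton–Brué–Colombo's theorem, whose Def. 1.1 takes `f` in a Bochner space
on the slab and whose Thm. 1.2 asks the equations in the sense of distributions on `ℝ³ × (0,T)`
(arXiv:2112.03116, p. 3); no `_holds` theorem formalising the printed result can land *for this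
statement*, and none should (the vacuous proof is deliberately not named `_holds`). The corrected
statement is not meaning-preserving for this declaration's users (`ForcedLerayHopfNonuniquenessProofs.lean`
derives it from the measurability-free single-viscosity rendering), whence the new name. Kept
verbatim, statement unchanged, under its ledger-referenced name; the structured barrier block it
carried was moved out of the catalogue (its audited content lives in the block of
`ForcedLerayHopfNonuniquenessNarrow`). *Original content* — for every `ν > 0` (printed for `ν = 1`;
general `ν` by the Navier–Stokes scaling) there are `T > 0` and a body force "`f ∈ L¹(0,T; L²(ℝ³))`"
(slice-wise only) such that the forced system on `ℝ³ × (0,T)` with ZERO initial datum has two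
Leray–Hopf weak solutions (accepted `IsLerayHopfOn T ν f 0 ·`) which differ on a set of positive
measure at some time `t ∈ (0,T)`. A mis-rendering of Albritton–Brué–Colombo 2022, Thm. 1.2 with
Def. 1.1. [cite: AlbrittonBrueColombo2022AnnMath, Def. 1.1 and Thm. 1.2 (p. 3)] -/
@[deprecated ForcedLerayHopfNonuniquenessNarrow (since := "2026-08-16")]
def ForcedLerayHopfNonuniqueness : Prop :=
  Literature.Analysis.FluidPDE.albritton_brue_colombo

/-- **Deprecated with `ForcedLerayHopfNonuniqueness` (verdict clean-up 2026-08-16).** The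
deprecated rendering is, by definition, the in-tree named fact
`Literature.Analysis.FluidPDE.albritton_brue_colombo` (ns.S20, itself without measurability
clause and vacuously provable, `ABCVacuity.rendering_is_vacuous`). For the faithful statement use
`ForcedLerayHopfNonuniquenessNarrow.albritton_brue_colombo_unit` /
`ForcedLerayHopfNonuniquenessNarrow.forall_viscosity`. [cite: AlbrittonBrueColombo2022AnnMath, Thm. 1.2] -/
@[deprecated "names the deprecated (vacuous) rendering `ForcedLerayHopfNonuniqueness`; the \
  faithful statement is `ForcedLerayHopfNonuniquenessNarrow` \
  (`.albritton_brue_colombo_unit`, `.forall_viscosity`)" (since := "2026-08-16")]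
theorem forcedLerayHopfNonuniqueness_iff :
    ForcedLerayHopfNonuniqueness ↔ Literature.Analysis.FluidPDE.albritton_brue_colombo :=
  Iff.rfl

/-- **Deprecated with `ForcedLerayHopfNonuniqueness` (verdict clean-up 2026-08-16).** The `ν = 1`
instance of the deprecated rendering: some `T > 0`, some slice-wise `f ∈ L¹(0,T; L²(ℝ³))` (no
measurability in time), and two Leray–Hopf solutions from `u₀ = 0` that differ at a time in
`(0,T)` — the statement of `ABCVacuity.unit_rendering_is_vacuous`, equally vacuous. The faithful
`ν = 1` statement (Albritton–Brué–Colombo 2022, Thm. 1.2 with Def. 1.1) is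
`Literature.Analysis.FluidPDE.albritton_brue_colombo_unit`, reached from the catalogued barrier by
`ForcedLerayHopfNonuniquenessNarrow.albritton_brue_colombo_unit`. [cite: AlbrittonBrueColombo2022AnnMath, Thm. 1.2] -/
@[deprecated ForcedLerayHopfNonuniquenessNarrow.albritton_brue_colombo_unit (since := "2026-08-16")]
theorem ForcedLerayHopfNonuniqueness.at_viscosity_one (h : ForcedLerayHopfNonuniqueness) :
    ∃ T : ℝ, 0 < T ∧ ∃ f : ℝ → EuclideanSpace ℝ (Fin 3) → EuclideanSpace ℝ (Fin 3),
      Literature.Analysis.FluidPDE.MemLqLp 1 2 f (Ioo 0 T) ∧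
      ∃ u v : ℝ → EuclideanSpace ℝ (Fin 3) → EuclideanSpace ℝ (Fin 3),
        Literature.Analysis.FluidPDE.IsLerayHopfOn T 1 f 0 u ∧ Literature.Analysis.FluidPDE.IsLerayHopfOn T 1 f 0 v ∧
        ∃ t ∈ Ioo 0 T, ¬ (u t =ᵐ[volume] v t) :=
  h 1 one_pos

/-- **Deprecated with `ForcedLerayHopfNonuniqueness` (verdict clean-up 2026-08-16).** The
narrowed fact implies the deprecated every-viscosity rendering (no measurability clause), through
`albritton_brue_colombo_unit` and the proved viscosity scaling
`Literature.Analysis.FluidPDE.albritton_brue_colombo_of_unit`. The converse is not available —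
the deprecated rendering is vacuously provable (`ABCVacuity.rendering_is_vacuous`). The faithful
every-viscosity consequence, WITH the measurability clause, is
`ForcedLerayHopfNonuniquenessNarrow.forall_viscosity`. [cite: AlbrittonBrueColombo2022AnnMath, Thm. 1.2] -/
@[deprecated ForcedLerayHopfNonuniquenessNarrow.forall_viscosity (since := "2026-08-16")]
theorem ForcedLerayHopfNonuniquenessNarrow.forcedLerayHopfNonuniqueness
    (h : ForcedLerayHopfNonuniquenessNarrow) : ForcedLerayHopfNonuniqueness :=
  Literature.Analysis.FluidPDE.albritton_brue_colombo_of_unit h.albritton_brue_colombo_unit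

section Profiles

open Filter
open scoped ENNReal
open Literature.Analysis.FluidPDE Literature.Analysis.FluidPDE.AlbrittonBrueColombo2022

/-- **`u ∈ L^∞(0,T; L³)` for the similarity ansatz** ((1.13), `p = 3`, `k = 0`): if `(U, P)` is a
classical solution of the similarity system (1.9) on `τ < τ₁` with `sup_τ ‖U(τ)‖₃³ ≤ M < ∞`, then
`physVelocity U ∈ L^∞(0,T; L³(ℝ³))` for every `T ≤ e^{τ₁}`, in the guarded sense
`MemLqLp ⊤ 3 · (Ioo 0 T)`: `‖u(t)‖₃ = ‖U(log t)‖₃ ≤ M^{1/3}`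
(`lintegral_enorm_cube_physVelocity`) and the slices are continuous. [cite: AlbrittonBrueColombo2022AnnMath, (1.13)] -/
theorem memLqLp_top_three_physVelocity {τ₁ T : ℝ} {M : ℝ≥0∞} (hM : M ≠ ⊤)
    {F U : ℝ → EuclideanSpace ℝ (Fin 3) → EuclideanSpace ℝ (Fin 3)}
    {P : ℝ → EuclideanSpace ℝ (Fin 3) → ℝ}
    (h : IsSimilarityNSSolutionOn (Iio τ₁) F U P) (hTT₁ : T ≤ Real.exp τ₁)
    (hU3 : ∀ τ < τ₁, ∫⁻ ξ, ‖U τ ξ‖ₑ ^ (3 : ℕ) ≤ M) :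
    Literature.Analysis.FluidPDE.MemLqLp ⊤ 3 (physVelocity U) (Ioo 0 T) := by
  have hlog : ∀ {t : ℝ}, t ∈ Ioo 0 T → Real.log t < τ₁ := fun ht =>
    (Real.log_lt_iff_lt_exp ht.1).2 (ht.2.trans_le hTT₁)
  have hcl : IsClassicalNSSolutionOn (Ioo 0 (Real.exp τ₁)) 1 (physForce F) (physVelocity U)
      (physPressure P) := h.isClassicalNSSolutionOn_phys_Iio
  have hbd : ∀ t ∈ Ioo 0 T, eLpNorm (physVelocity U t) 3 volume ≤ M ^ (1 / 3 : ℝ) := by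
    intro t ht
    rw [eLpNorm_eq_lintegral_rpow_enorm_toReal (by norm_num) (by norm_num), ENNReal.toReal_ofNat]
    have h3 : ∫⁻ x, ‖physVelocity U t x‖ₑ ^ (3 : ℝ) = ∫⁻ x, ‖physVelocity U t x‖ₑ ^ (3 : ℕ) :=
      lintegral_congr fun x => by rw [← ENNReal.rpow_natCast]; norm_num
    rw [h3, lintegral_enorm_cube_physVelocity ht.1 U]
    gcongr
    exact hU3 _ (hlog ht)
  have hmeas : ∀ t ∈ Ioo 0 T, AEStronglyMeasurable (physVelocity U t) volume := fun t ht =>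
    (hcl.contDiff_velocity ⟨ht.1, ht.2.trans_le hTT₁⟩).continuous.aestronglyMeasurable
  have hC : M ^ (1 / 3 : ℝ) ≠ ⊤ := ENNReal.rpow_ne_top_of_nonneg (by norm_num) hM
  refine memLqLp_of_ae_eLpNorm_le hC measure_Ioo_lt_top.ne ?_ ?_
  · refine (ae_restrict_iff' measurableSet_Ioo).2 (Eventually.of_forall fun t ht => ?_)
    exact ⟨hmeas t ht, (hbd t ht).trans_lt hC.lt_top⟩
  · exact (ae_restrict_iff' measurableSet_Ioo).2 (Eventually.of_forall fun t ht => hbd t ht)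

/-- **The Type-I bound of the similarity ansatz** ((1.13), `p = ∞`, `k = 0`): a pointwise bound
`‖U(τ, ξ)‖ ≤ K` on `τ < τ₁` gives `√t ‖physVelocity U t x‖ ≤ K` for `0 < t < T ≤ e^{τ₁}`
(`physVelocity U t x = (√t)⁻¹ U(log t, x/√t)`). [cite: AlbrittonBrueColombo2022AnnMath, (1.13)] -/
theorem sqrt_mul_norm_physVelocity_le {τ₁ T K : ℝ}
    {U : ℝ → EuclideanSpace ℝ (Fin 3) → EuclideanSpace ℝ (Fin 3)} (hTT₁ : T ≤ Real.exp τ₁)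
    (hU : ∀ τ < τ₁, ∀ ξ, ‖U τ ξ‖ ≤ K) {t : ℝ} (ht : t ∈ Ioo 0 T) (x : EuclideanSpace ℝ (Fin 3)) :
    Real.sqrt t * ‖physVelocity U t x‖ ≤ K := by
  have hlog : Real.log t < τ₁ := (Real.log_lt_iff_lt_exp ht.1).2 (ht.2.trans_le hTT₁)
  have hs : 0 < Real.sqrt t := Real.sqrt_pos.2 ht.1
  rw [physVelocity_apply, norm_smul, norm_inv, Real.norm_eq_abs, abs_of_pos hs, ← mul_assoc,
    mul_inv_cancel₀ hs.ne', one_mul]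
  exact hU _ hlog _

/-- **The narrowed barrier from Theorem 1.3-type profile data** (same root debt as
`albritton_brue_colombo_unit`): if the similarity system (1.9) with ONE force profile `F` has TWO
classical solutions `(U₁, P₁)`, `(U₂, P₂)` on `τ < τ₁` with the uniform `L²`, `Ḣ¹`, `L³`, `L∞`
bounds that Thm. 1.3 (b) provides for `U₁ = Ū` and `U₂ = Ū + U^{lin} + U^{per}` (there:
`Ū ∈ C_c^∞`, `η ∈ ∩_k H^k`, `‖U^{per}(τ)‖_{H^k} ≲ e^{2aτ}`, so all `H^k`, hence `L³` and `L^∞`,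
norms are bounded as `τ → −∞`), differing at some `τ₀ < τ₁` on a set of positive measure, then
`ForcedLerayHopfNonuniquenessNarrow` holds with `T = (e^{τ₀} + e^{τ₁})/2`, `f = physForce F`
(jointly measurable because continuous, being the force of a classical solution;
`L¹(0,T;L²)` by `memLqLp_physForce`), `u = physVelocity U₁`, `v = physVelocity U₂` (Leray–Hopf by
`IsSimilarityNSSolutionOn.isLerayHopfOn_phys`; `L^∞_t L³_x` by `memLqLp_top_three_physVelocity`;
Type-I by `sqrt_mul_norm_physVelocity_le`; classical on `(0,T)` by
`isClassicalNSSolutionOn_phys_Iio` restricted; distinct at `e^{τ₀}` by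
`not_ae_eq_physVelocity_exp`). What is NOT proved is an inhabitant of the hypotheses — the
analytic core of the paper (Vishik's unstable vortex and its ring lift §2, the spectral
perturbation §3, the nonlinear instability Thm. 4.1). [cite: AlbrittonBrueColombo2022AnnMath, Thm. 1.3 ⟹ Thm. 1.2, with (1.13)–(1.14)] -/
theorem forcedLerayHopfNonuniquenessNarrow_of_similarityProfiles {τ₁ : ℝ}
    {F U₁ U₂ : ℝ → EuclideanSpace ℝ (Fin 3) → EuclideanSpace ℝ (Fin 3)}
    {P₁ P₂ : ℝ → EuclideanSpace ℝ (Fin 3) → ℝ} {M : ℝ≥0∞} (hM : M ≠ ⊤) {K : ℝ}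
    (h₁ : IsSimilarityNSSolutionOn (Iio τ₁) F U₁ P₁) (h₂ : IsSimilarityNSSolutionOn (Iio τ₁) F U₂ P₂)
    (hU2 : ∀ τ < τ₁, ∫⁻ ξ, ‖U₁ τ ξ‖ₑ ^ 2 ≤ M ∧ ∫⁻ ξ, ‖U₂ τ ξ‖ₑ ^ 2 ≤ M)
    (hDU : ∀ τ < τ₁, ∫⁻ ξ, ENNReal.ofReal (frobeniusNormSq (fderiv ℝ (U₁ τ) ξ)) ≤ M ∧
      ∫⁻ ξ, ENNReal.ofReal (frobeniusNormSq (fderiv ℝ (U₂ τ) ξ)) ≤ M)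
    (hU3 : ∀ τ < τ₁, ∫⁻ ξ, ‖U₁ τ ξ‖ₑ ^ (3 : ℕ) ≤ M ∧ ∫⁻ ξ, ‖U₂ τ ξ‖ₑ ^ (3 : ℕ) ≤ M)
    (hP2 : ∀ τ < τ₁, ∫⁻ ξ, ‖P₁ τ ξ‖ₑ ^ 2 ≤ M ∧ ∫⁻ ξ, ‖P₂ τ ξ‖ₑ ^ 2 ≤ M)
    (hF2 : ∀ τ < τ₁, ∫⁻ ξ, ‖F τ ξ‖ₑ ^ 2 ≤ M)
    (hK : ∀ τ < τ₁, ∀ ξ, ‖U₁ τ ξ‖ ≤ K ∧ ‖U₂ τ ξ‖ ≤ K)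
    (hne : ∃ τ₀ < τ₁, ¬ (U₁ τ₀ =ᵐ[volume] U₂ τ₀)) :
    ForcedLerayHopfNonuniquenessNarrow := by
  obtain ⟨τ₀, hτ₀, hne⟩ := hne
  set t₀ : ℝ := Real.exp τ₀ with ht₀_def
  set T : ℝ := (t₀ + Real.exp τ₁) / 2 with hT_def
  have ht₀T₁ : t₀ < Real.exp τ₁ := Real.exp_lt_exp.2 hτ₀
  have ht₀ : 0 < t₀ := Real.exp_pos τ₀
  have hT : 0 < T := by rw [hT_def]; positivity
  have ht₀T : t₀ < T := by rw [hT_def]; linarith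
  have hTT₁ : T < Real.exp τ₁ := by rw [hT_def]; linarith
  have hlog : ∀ {t : ℝ}, t ∈ Ioo 0 T → Real.log t < τ₁ := fun ht =>
    (Real.log_lt_iff_lt_exp ht.1).2 (ht.2.trans hTT₁)
  -- the two classical solutions on the open strip `(0, e^{τ₁}) × ℝ³`, restricted to `(0, T)`
  have hcl₁ : IsClassicalNSSolutionOn (Ioo 0 (Real.exp τ₁)) 1 (physForce F) (physVelocity U₁)
      (physPressure P₁) := h₁.isClassicalNSSolutionOn_phys_Iio
  have hcl₂ : IsClassicalNSSolutionOn (Ioo 0 (Real.exp τ₁)) 1 (physForce F) (physVelocity U₂)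
      (physPressure P₂) := h₂.isClassicalNSSolutionOn_phys_Iio
  have hsub : Ioo 0 T ⊆ Ioo 0 (Real.exp τ₁) := Ioo_subset_Ioo_right hTT₁.le
  -- the force is the force of a classical solution, hence continuous, hence jointly measurable
  have hmeas : AEStronglyMeasurable (Function.uncurry (physForce F)) (volume.restrict (Ioo 0 T ×ˢ univ)) :=
    ((hcl₁.continuousOn_force isOpen_Ioo.uniqueDiffOn).mono
      (prod_mono hsub Subset.rfl)).aestronglyMeasurable (measurableSet_Ioo.prod MeasurableSet.univ)
  refine ⟨T, hT, physForce F, hmeas, ?_, physVelocity U₁, physVelocity U₂,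
    h₁.isLerayHopfOn_phys hM (fun τ hτ => (hU2 τ hτ).1) (fun τ hτ => (hDU τ hτ).1)
      (fun τ hτ => (hU3 τ hτ).1) (fun τ hτ => (hP2 τ hτ).1) hF2 hT hTT₁,
    h₂.isLerayHopfOn_phys hM (fun τ hτ => (hU2 τ hτ).2) (fun τ hτ => (hDU τ hτ).2)
      (fun τ hτ => (hU3 τ hτ).2) (fun τ hτ => (hP2 τ hτ).2) hF2 hT hTT₁,
    memLqLp_top_three_physVelocity hM h₁ hTT₁.le fun τ hτ => (hU3 τ hτ).1,
    memLqLp_top_three_physVelocity hM h₂ hTT₁.le fun τ hτ => (hU3 τ hτ).2,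
    ⟨K, fun t ht x => ⟨sqrt_mul_norm_physVelocity_le hTT₁.le (fun τ hτ ξ => (hK τ hτ ξ).1) ht x,
      sqrt_mul_norm_physVelocity_le hTT₁.le (fun τ hτ ξ => (hK τ hτ ξ).2) ht x⟩⟩,
    ⟨physPressure P₁, physPressure P₂, hcl₁.mono hsub (uniqueDiffOn_Ioo 0 T),
      hcl₂.mono hsub (uniqueDiffOn_Ioo 0 T)⟩,
    t₀, ⟨ht₀, ht₀T⟩, not_ae_eq_physVelocity_exp hne⟩
  -- `f ∈ L¹(0, T; L²)`
  refine memLqLp_physForce hT hM (fun t ht => ?_) (fun t ht => hF2 _ (hlog ht))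
  exact (hcl₁.continuous_force_slice isOpen_Ioo.uniqueDiffOn (hsub ht)).aestronglyMeasurable

end Profiles

end Literature.Barriers.NavierStokesRegularity
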